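import Mathlib
import Summits.Ventures.LatticeQCDFlow.Scaling.TiltedCovarianceJet

/-!
# LatticeQCDFlow / Scaling — the covariance jet from ATOMIC moments
# (the bookkeeping between the lattice facts and `cov_jetEq_of_moments`)

HONEST FRAMING: exact (Metropolis-corrected) sampling algorithms for lattice gauge theory;
figures of merit are autocorrelation/cost numbers at stated couplings and volumes; no
continuum-physics claim.

Venture `LatticeQCDFlow` (cell pub-lqcd), topic `Scaling`, FANOUT row 30 (lean-1) — OUR WORK, part
of the leading-coefficient identity (LC) of theory2 item 120 (HOME/lean/theory2/LANDING.md §32).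
`Scaling/TiltedCovarianceJet.lean` turns fourteen moments of `(X, Y, C)` into the jet
`⟨XY⟩_β − ⟨X⟩_β⟨Y⟩_β = β⁴/32 + O(β⁵)`.  On the lattice `C = X + Y + C'` (`C'` = the other plaquette
cosines) and what one computes are the ATOMIC moments `E[XᵅYᵝC'ˡ]`:
`E[XᵅYᵝ] = m_α m_β` (`m = 1, 0, 1/2, 0, 3/8`), `E[XᵅYᵝC'] = 0`, `E[XᵅYᵝC'²] = λ m_α m_β`,
`E[X YᵝC'³] = E[XᵅY C'³] = 0`, `E[XYC'⁴] = 3/4`.  `cov_jetEq_of_atomic` expands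
`(X + Y + C')ᵏ` (multinomial bookkeeping through the monomial sums `msum`) and feeds
`cov_jetEq_of_moments`.  Elementary; nothing is cited as a fact; one `def` (`msum`), no `sorry`.
-/

noncomputable section

open MeasureTheory Filter Topology Asymptotics Finset
open Literature.MathematicalPhysics.QuantumFieldTheory (JetEq BddAt)

namespace Summit.Ventures.LatticeQCDFlow.Theory2.Tilted

variable {Ω : Type*} [MeasurableSpace Ω]

/-- Sums of scaled monomials `c · Xᵅ Yᵝ C'ˡ` listed as `(c, α, β, l)`. [folklore] -/
def msum (X Y C' : Ω → ℝ) : List (ℝ × ℕ × ℕ × ℕ) → Ω → ℝ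
  | [] => fun _ => 0
  | t :: ts => fun ω => t.1 * (X ω ^ t.2.1 * Y ω ^ t.2.2.1 * C' ω ^ t.2.2.2) + msum X Y C' ts ω

section Bridge

variable {ν : Measure Ω} [IsProbabilityMeasure ν] {X Y C' : Ω → ℝ} {BX BY BC : ℝ}

/-- Monomials in bounded measurable functions are integrable. [folklore] -/
theorem integrable_monomial (hXm : Measurable X) (hYm : Measurable Y) (hCm : Measurable C')
    (hXb : ∀ ω, |X ω| ≤ BX) (hYb : ∀ ω, |Y ω| ≤ BY) (hCb : ∀ ω, |C' ω| ≤ BC) (α β l : ℕ) :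
    Integrable (fun ω => X ω ^ α * Y ω ^ β * C' ω ^ l) ν := by
  refine Integrable.of_bound (((hXm.pow_const α).mul (hYm.pow_const β)).mul
    (hCm.pow_const l)).aestronglyMeasurable (BX ^ α * BY ^ β * BC ^ l)
    (Eventually.of_forall fun ω => ?_)
  rw [Real.norm_eq_abs, abs_mul, abs_mul, abs_pow, abs_pow, abs_pow]
  have hBX : 0 ≤ BX := (abs_nonneg _).trans (hXb ω)
  have hBY : 0 ≤ BY := (abs_nonneg _).trans (hYb ω)
  gcongr
  · exact hXb ω
  · exact hYb ω
  · exact hCb ω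

/-- Integrating a monomial sum term by term. [folklore] -/
theorem integral_msum (hXm : Measurable X) (hYm : Measurable Y) (hCm : Measurable C')
    (hXb : ∀ ω, |X ω| ≤ BX) (hYb : ∀ ω, |Y ω| ≤ BY) (hCb : ∀ ω, |C' ω| ≤ BC) :
    ∀ ts : List (ℝ × ℕ × ℕ × ℕ), (Integrable (msum X Y C' ts) ν ∧
      ∫ ω, msum X Y C' ts ω ∂ν =
        (ts.map fun t => t.1 * ∫ ω, X ω ^ t.2.1 * Y ω ^ t.2.2.1 * C' ω ^ t.2.2.2 ∂ν).sum)
  | [] => by simp [msum]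
  | t :: ts => by
    obtain ⟨hint, heq⟩ := integral_msum hXm hYm hCm hXb hYb hCb ts
    have h1 : Integrable (fun ω => t.1 * (X ω ^ t.2.1 * Y ω ^ t.2.2.1 * C' ω ^ t.2.2.2)) ν :=
      (integrable_monomial hXm hYm hCm hXb hYb hCb _ _ _).const_mul _
    refine ⟨h1.add hint, ?_⟩
    simp only [msum, List.map_cons, List.sum_cons]
    rw [integral_add h1 hint, integral_const_mul, heq]

/-- **THE COVARIANCE JET FROM ATOMIC MOMENTS.**  `X, Y, C'` bounded measurable on a probability
space with `E[XᵅYᵝ] = m_α m_β` (`m₀ = 1, m₁ = 0, m₂ = 1/2, m₃ = 0, m₄ = 3/8`), `E[XᵅYᵝC'] = 0`,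
`E[XᵅYᵝC'²] = λ m_α m_β`, `E[X¹YᵝC'³] = E[XᵅY¹C'³] = 0`, `E[X¹Y¹C'⁴] = 3/4`: then for
`C = X + Y + C'` the tilted covariance `⟨XY⟩_β − ⟨X⟩_β⟨Y⟩_β` is `β⁴/32 + O(β⁵)`. [folklore] -/
theorem cov_jetEq_of_atomic (hXm : Measurable X) (hYm : Measurable Y) (hCm : Measurable C')
    (hXb : ∀ ω, |X ω| ≤ BX) (hYb : ∀ ω, |Y ω| ≤ BY) (hCb : ∀ ω, |C' ω| ≤ BC)
    {m : ℕ → ℝ} (hm0 : m 0 = 1) (hm1 : m 1 = 0) (hm2 : m 2 = 1 / 2) (hm3 : m 3 = 0)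
    (hm4 : m 4 = 3 / 8) {lam : ℝ}
    (hA0 : ∀ α β : ℕ, ∫ ω, X ω ^ α * Y ω ^ β ∂ν = m α * m β)
    (hS1 : ∀ α β : ℕ, ∫ ω, X ω ^ α * Y ω ^ β * C' ω ^ 1 ∂ν = 0)
    (hS2 : ∀ α β : ℕ, ∫ ω, X ω ^ α * Y ω ^ β * C' ω ^ 2 ∂ν = lam * (m α * m β))
    (hS3a : ∀ β : ℕ, ∫ ω, X ω ^ 1 * Y ω ^ β * C' ω ^ 3 ∂ν = 0)
    (hS3b : ∀ α : ℕ, ∫ ω, X ω ^ α * Y ω ^ 1 * C' ω ^ 3 ∂ν = 0)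
    (hS4 : ∫ ω, X ω ^ 1 * Y ω ^ 1 * C' ω ^ 4 ∂ν = 3 / 4) :
    JetEq 5
      (fun β => tilt ν (fun ω => X ω + Y ω + C' ω) (fun ω => ((X ω * Y ω : ℝ) : ℂ)) β /
          tilt ν (fun ω => X ω + Y ω + C' ω) (fun _ => 1) β -
        tilt ν (fun ω => X ω + Y ω + C' ω) (fun ω => (X ω : ℂ)) β /
            tilt ν (fun ω => X ω + Y ω + C' ω) (fun _ => 1) β *
          (tilt ν (fun ω => X ω + Y ω + C' ω) (fun ω => (Y ω : ℂ)) β /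
            tilt ν (fun ω => X ω + Y ω + C' ω) (fun _ => 1) β))
      (fun β => β ^ 4 / 32) := by
  have hBX : 0 ≤ BX := (abs_nonneg _).trans (hXb (Classical.choice (by
    by_contra h
    rw [not_nonempty_iff] at h
    have := IsProbabilityMeasure.measure_univ (μ := ν)
    rw [Set.univ_eq_empty_iff.2 h, measure_empty] at this
    exact zero_ne_one this)))
  have hBY : 0 ≤ BY := by
    obtain ⟨ω⟩ : Nonempty Ω := by
      by_contra h
      rw [not_nonempty_iff] at h
      have := IsProbabilityMeasure.measure_univ (μ := ν)
      rw [Set.univ_eq_empty_iff.2 h, measure_empty] at this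
      exact zero_ne_one this
    exact (abs_nonneg _).trans (hYb ω)
  -- the total `C` is bounded measurable
  have hCm' : Measurable fun ω => X ω + Y ω + C' ω := (hXm.add hYm).add hCm
  have hCb' : ∀ ω, |X ω + Y ω + C' ω| ≤ BX + BY + BC := fun ω =>
    (abs_add_le _ _).trans (add_le_add ((abs_add_le _ _).trans (add_le_add (hXb ω) (hYb ω))) (hCb ω))
  have hM : 0 ≤ BX + BY + BC := by
    have := hCb' (Classical.choice (by
      by_contra h
      rw [not_nonempty_iff] at h
      have := IsProbabilityMeasure.measure_univ (μ := ν)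
      rw [Set.univ_eq_empty_iff.2 h, measure_empty] at this
      exact zero_ne_one this))
    exact (abs_nonneg _).trans this
  -- evaluation rules for the monomial integrals
  have R0 : ∀ α β : ℕ, ∫ ω, X ω ^ α * Y ω ^ β * C' ω ^ 0 ∂ν = m α * m β := by
    intro α β; simp only [pow_zero, mul_one]; exact hA0 α β
  have IM := fun ts => (integral_msum (ν := ν) hXm hYm hCm hXb hYb hCb ts).2
  have hC1 : ∫ ω, (X ω + Y ω + C' ω) ∂ν = (0 : ℝ) := by
    have e : (fun ω => (X ω + Y ω + C' ω)) = msum X Y C' [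
        ((1 : ℝ), 0, 0, 1), ((1 : ℝ), 0, 1, 0), ((1 : ℝ), 1, 0, 0)] := by
      funext ω; simp only [msum]; ring
    rw [e, IM]
    simp only [List.map_cons, List.map_nil, List.sum_cons, List.sum_nil,
      hS1, R0, hm0, hm1]
    ring
  have hC2 : ∫ ω, (X ω + Y ω + C' ω) ^ 2 ∂ν = (1 : ℝ) + lam := by
    have e : (fun ω => (X ω + Y ω + C' ω) ^ 2) = msum X Y C' [
        ((1 : ℝ), 0, 0, 2), ((2 : ℝ), 0, 1, 1), ((1 : ℝ), 0, 2, 0), ((2 : ℝ), 1, 0, 1),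
        ((2 : ℝ), 1, 1, 0), ((1 : ℝ), 2, 0, 0)] := by
      funext ω; simp only [msum]; ring
    rw [e, IM]
    simp only [List.map_cons, List.map_nil, List.sum_cons, List.sum_nil,
      hS2, hm0, hS1, R0, hm2, hm1]
    ring
  have hX0 : ∫ ω, X ω ∂ν = (0 : ℝ) := by
    have e : (fun ω => X ω) = msum X Y C' [
        ((1 : ℝ), 1, 0, 0)] := by
      funext ω; simp only [msum]; ring
    rw [e, IM]
    simp only [List.map_cons, List.map_nil, List.sum_cons, List.sum_nil,
      R0, hm1, hm0]
    ring
  have hX1 : ∫ ω, X ω * (X ω + Y ω + C' ω) ∂ν = ((1 : ℝ) / 2) := by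
    have e : (fun ω => X ω * (X ω + Y ω + C' ω)) = msum X Y C' [
        ((1 : ℝ), 1, 0, 1), ((1 : ℝ), 1, 1, 0), ((1 : ℝ), 2, 0, 0)] := by
      funext ω; simp only [msum]; ring
    rw [e, IM]
    simp only [List.map_cons, List.map_nil, List.sum_cons, List.sum_nil,
      hS1, R0, hm1, hm2, hm0]
    ring
  have hX2 : ∫ ω, X ω * (X ω + Y ω + C' ω) ^ 2 ∂ν = (0 : ℝ) := by
    have e : (fun ω => X ω * (X ω + Y ω + C' ω) ^ 2) = msum X Y C' [
        ((1 : ℝ), 1, 0, 2), ((2 : ℝ), 1, 1, 1), ((1 : ℝ), 1, 2, 0), ((2 : ℝ), 2, 0, 1),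
        ((2 : ℝ), 2, 1, 0), ((1 : ℝ), 3, 0, 0)] := by
      funext ω; simp only [msum]; ring
    rw [e, IM]
    simp only [List.map_cons, List.map_nil, List.sum_cons, List.sum_nil,
      hS2, hm1, hm0, hS1, R0, hm2, hm3]
    ring
  have hX3 : ∫ ω, X ω * (X ω + Y ω + C' ω) ^ 3 ∂ν = ((9 : ℝ) / 8) + ((3 : ℝ) / 2) * lam := by
    have e : (fun ω => X ω * (X ω + Y ω + C' ω) ^ 3) = msum X Y C' [
        ((1 : ℝ), 1, 0, 3), ((3 : ℝ), 1, 1, 2), ((3 : ℝ), 1, 2, 1), ((1 : ℝ), 1, 3, 0),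
        ((3 : ℝ), 2, 0, 2), ((6 : ℝ), 2, 1, 1), ((3 : ℝ), 2, 2, 0), ((3 : ℝ), 3, 0, 1),
        ((3 : ℝ), 3, 1, 0), ((1 : ℝ), 4, 0, 0)] := by
      funext ω; simp only [msum]; ring
    rw [e, IM]
    simp only [List.map_cons, List.map_nil, List.sum_cons, List.sum_nil,
      hS3a, hS2, hm1, hS1, R0, hm3, hm2, hm0, hm4]
    ring
  have hY0 : ∫ ω, Y ω ∂ν = (0 : ℝ) := by
    have e : (fun ω => Y ω) = msum X Y C' [
        ((1 : ℝ), 0, 1, 0)] := by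
      funext ω; simp only [msum]; ring
    rw [e, IM]
    simp only [List.map_cons, List.map_nil, List.sum_cons, List.sum_nil,
      R0, hm0, hm1]
    ring
  have hY1 : ∫ ω, Y ω * (X ω + Y ω + C' ω) ∂ν = ((1 : ℝ) / 2) := by
    have e : (fun ω => Y ω * (X ω + Y ω + C' ω)) = msum X Y C' [
        ((1 : ℝ), 0, 1, 1), ((1 : ℝ), 0, 2, 0), ((1 : ℝ), 1, 1, 0)] := by
      funext ω; simp only [msum]; ring
    rw [e, IM]
    simp only [List.map_cons, List.map_nil, List.sum_cons, List.sum_nil,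
      hS1, R0, hm0, hm2, hm1]
    ring
  have hY2 : ∫ ω, Y ω * (X ω + Y ω + C' ω) ^ 2 ∂ν = (0 : ℝ) := by
    have e : (fun ω => Y ω * (X ω + Y ω + C' ω) ^ 2) = msum X Y C' [
        ((1 : ℝ), 0, 1, 2), ((2 : ℝ), 0, 2, 1), ((1 : ℝ), 0, 3, 0), ((2 : ℝ), 1, 1, 1),
        ((2 : ℝ), 1, 2, 0), ((1 : ℝ), 2, 1, 0)] := by
      funext ω; simp only [msum]; ring
    rw [e, IM]
    simp only [List.map_cons, List.map_nil, List.sum_cons, List.sum_nil,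
      hS2, hm0, hm1, hS1, R0, hm3, hm2]
    ring
  have hY3 : ∫ ω, Y ω * (X ω + Y ω + C' ω) ^ 3 ∂ν = ((9 : ℝ) / 8) + ((3 : ℝ) / 2) * lam := by
    have e : (fun ω => Y ω * (X ω + Y ω + C' ω) ^ 3) = msum X Y C' [
        ((1 : ℝ), 0, 1, 3), ((3 : ℝ), 0, 2, 2), ((3 : ℝ), 0, 3, 1), ((1 : ℝ), 0, 4, 0),
        ((3 : ℝ), 1, 1, 2), ((6 : ℝ), 1, 2, 1), ((3 : ℝ), 1, 3, 0), ((3 : ℝ), 2, 1, 1),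
        ((3 : ℝ), 2, 2, 0), ((1 : ℝ), 3, 1, 0)] := by
      funext ω; simp only [msum]; ring
    rw [e, IM]
    simp only [List.map_cons, List.map_nil, List.sum_cons, List.sum_nil,
      hS3b, hS2, hm0, hm2, hS1, R0, hm4, hm1, hm3]
    ring
  have hXY0 : ∫ ω, X ω * Y ω ∂ν = (0 : ℝ) := by
    have e : (fun ω => X ω * Y ω) = msum X Y C' [
        ((1 : ℝ), 1, 1, 0)] := by
      funext ω; simp only [msum]; ring
    rw [e, IM]
    simp only [List.map_cons, List.map_nil, List.sum_cons, List.sum_nil,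
      R0, hm1]
    ring
  have hXY1 : ∫ ω, X ω * Y ω * (X ω + Y ω + C' ω) ∂ν = (0 : ℝ) := by
    have e : (fun ω => X ω * Y ω * (X ω + Y ω + C' ω)) = msum X Y C' [
        ((1 : ℝ), 1, 1, 1), ((1 : ℝ), 1, 2, 0), ((1 : ℝ), 2, 1, 0)] := by
      funext ω; simp only [msum]; ring
    rw [e, IM]
    simp only [List.map_cons, List.map_nil, List.sum_cons, List.sum_nil,
      hS1, R0, hm1, hm2]
    ring
  have hXY2 : ∫ ω, X ω * Y ω * (X ω + Y ω + C' ω) ^ 2 ∂ν = ((1 : ℝ) / 2) := by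
    have e : (fun ω => X ω * Y ω * (X ω + Y ω + C' ω) ^ 2) = msum X Y C' [
        ((1 : ℝ), 1, 1, 2), ((2 : ℝ), 1, 2, 1), ((1 : ℝ), 1, 3, 0), ((2 : ℝ), 2, 1, 1),
        ((2 : ℝ), 2, 2, 0), ((1 : ℝ), 3, 1, 0)] := by
      funext ω; simp only [msum]; ring
    rw [e, IM]
    simp only [List.map_cons, List.map_nil, List.sum_cons, List.sum_nil,
      hS2, hm1, hS1, R0, hm3, hm2]
    ring
  have hXY3 : ∫ ω, X ω * Y ω * (X ω + Y ω + C' ω) ^ 3 ∂ν = (0 : ℝ) := by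
    have e : (fun ω => X ω * Y ω * (X ω + Y ω + C' ω) ^ 3) = msum X Y C' [
        ((1 : ℝ), 1, 1, 3), ((3 : ℝ), 1, 2, 2), ((3 : ℝ), 1, 3, 1), ((1 : ℝ), 1, 4, 0),
        ((3 : ℝ), 2, 1, 2), ((6 : ℝ), 2, 2, 1), ((3 : ℝ), 2, 3, 0), ((3 : ℝ), 3, 1, 1),
        ((3 : ℝ), 3, 2, 0), ((1 : ℝ), 4, 1, 0)] := by
      funext ω; simp only [msum]; ring
    rw [e, IM]
    simp only [List.map_cons, List.map_nil, List.sum_cons, List.sum_nil,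
      hS3a, hS2, hm1, hm2, hS1, R0, hm4, hm3]
    ring
  have hXY4 : ∫ ω, X ω * Y ω * (X ω + Y ω + C' ω) ^ 4 ∂ν = ((9 : ℝ) / 4) + (3 : ℝ) * lam := by
    have e : (fun ω => X ω * Y ω * (X ω + Y ω + C' ω) ^ 4) = msum X Y C' [
        ((1 : ℝ), 1, 1, 4), ((4 : ℝ), 1, 2, 3), ((6 : ℝ), 1, 3, 2), ((4 : ℝ), 1, 4, 1),
        ((1 : ℝ), 1, 5, 0), ((4 : ℝ), 2, 1, 3), ((12 : ℝ), 2, 2, 2), ((12 : ℝ), 2, 3, 1),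
        ((4 : ℝ), 2, 4, 0), ((6 : ℝ), 3, 1, 2), ((12 : ℝ), 3, 2, 1), ((6 : ℝ), 3, 3, 0),
        ((4 : ℝ), 4, 1, 1), ((4 : ℝ), 4, 2, 0), ((1 : ℝ), 5, 1, 0)] := by
      funext ω; simp only [msum]; ring
    rw [e, IM]
    simp only [List.map_cons, List.map_nil, List.sum_cons, List.sum_nil,
      hS4, hS3a, hS2, hm1, hm3, hS1, R0, hS3b, hm2, hm4]
    ring
  exact cov_jetEq_of_moments hXm hYm hCm' hXb hYb hCb' hM hC1 hC2 hX0 hX1 hX2 hX3 hY0 hY1 hY2 hY3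
    hXY0 hXY1 hXY2 hXY3 hXY4

end Bridge

end Summit.Ventures.LatticeQCDFlow.Theory2.Tilted

end
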